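import Literature.AlgebraicGeometry.Motives.AbelianVarietyRelFrobeniusDegree
import Literature.AlgebraicGeometry.Motives.AlbaneseByMaximality
import HarnessLib

/-!
# Factors of an isogeny through the relative Frobenius: isogeny, degree, isomorphism

Layer `Literature/AlgebraicGeometry/Motives`, namespace `Literature.AlgebraicGeometry.Motives.AbelianVariety`.  KERNEL ONLY:
theorems.  Cell `hodgecm-mathlib` (D-0151), programme E2 (height-one road to `shimuraTaniyamaPair_degOne'`), the
«ASM end of DEG» in A-p02's ROAD-E2 memo: once the reduced `𝔮`-multiplication `λ̃ : Ã → B̃` factors as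
`λ̃ = F_{Ã/κ} ≫ ψ` through the relative `q`-Frobenius (LIE0′ + the rational-factor lemma), `ψ` is an isogeny
(`isIsogeny_of_relFrobenius_comp_eq`), degrees multiply — `q^{dim} · deg ψ = deg λ̃`
(`pow_mul_kerRank_of_relFrobenius_comp_eq`, from `IsIsogeny.kerRank_comp` and `kerRank_relFrobenius`) — and
**`ψ` is an isomorphism as soon as `deg λ̃ = q^{dim}`** (`isIso_of_relFrobenius_comp_eq`, by
`IsIsogeny.isIso_of_kerRank_eq_one`); §2 packages this in the shape of the conclusion of
`shimuraTaniyamaPair_degOne'` (`exists_iso_of_relFrobenius_comp_eq`: `e : B ≅ A^{(q)}`, `λ ≫ e = F_{A/k}`,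
`β ≫ e = e ≫ α^{(q)}` whenever `α ≫ λ = λ ≫ β`, by cancelling the epimorphism `F_{A/k}`): Shimura's «`ν(λ̃) = ν(λ) = N𝔮 = q^n`, hence `Ỹ` is birational, hence an
isomorphism» ([Shimura1998] §13.1 proof of Thm. 1, pp. 97–99; §18.6 proof of Thm. 18.6, p. 127).  Kept apart from
`AbelianVarietyRelFrobeniusDegree` so that the latter does not import the Albanese/Jacobian closure of
`AlbaneseByMaximality`.

HC_CM is proved only modulo the printed citations until rung 0 closes; this file adds no hypothesis.

## References
* [Shimura1998] G. Shimura, *Abelian Varieties with Complex Multiplication and Modular Functions* (1998), §13.1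
  proof of Thm. 1 (pp. 97–99) and §18.6 proof of Thm. 18.6 (p. 127).
* [MumfordAV1970] D. Mumford, *Abelian Varieties*, §15 (p. 146).
-/

set_option autoImplicit false

noncomputable section

open CategoryTheory AlgebraicGeometry

universe u

namespace Literature.AlgebraicGeometry.Motives

namespace AbelianVariety

variable {k : Type u} [Field k] (p : ℕ) [ExpChar k p] (n : ℕ) {A B : AbelianVariety k}

/-- **A factor of an isogeny through `F_{A/k}` is an isogeny**: if `F_{A/k} ≫ ψ = λ` with `λ` an isogeny then
`ψ : A^{(q)} → B` is surjective between abelian varieties of the same dimension. [cite: Shimura1998, §13.1 proof of Thm. 1 (pp. 97–99)] -/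
theorem isIsogeny_of_relFrobenius_comp_eq (ψ : A.frobeniusTwist p n ⟶ B) {lam : A ⟶ B} (hlam : IsIsogeny lam)
    (h : A.relFrobenius p n ≫ ψ = lam) : IsIsogeny ψ := by
  haveI : Surjective (Hom.toSchemeHom (A.relFrobenius p n) ≫ Hom.toSchemeHom ψ) := by
    have e : Hom.toSchemeHom (A.relFrobenius p n) ≫ Hom.toSchemeHom ψ = Hom.toSchemeHom lam := by
      rw [← h]; rfl
    rw [e]; exact hlam.1
  haveI : Surjective (Hom.toSchemeHom ψ) := Surjective.of_comp (Hom.toSchemeHom (A.relFrobenius p n)) _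
  exact isIsogeny_of_surjective_of_dim_eq ψ ((A.dim_frobeniusTwist p n).trans (dim_eq_of_isIsogeny hlam))

/-- **`q^{dim A} · deg ψ = deg λ`** for a factorisation `F_{A/k} ≫ ψ = λ` of an isogeny `λ` over a perfect field
(degrees of isogenies multiply, `IsIsogeny.kerRank_comp`, and `deg F_{A/k} = q^{dim A}`, `kerRank_relFrobenius`).
[cite: Shimura1998, §13.1 proof of Thm. 1 (pp. 97–99)] [cite: MumfordAV1970, §15 (p. 146)] -/
theorem pow_mul_kerRank_of_relFrobenius_comp_eq [PerfectField k] (ψ : A.frobeniusTwist p n ⟶ B) {lam : A ⟶ B}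
    (hlam : IsIsogeny lam) (h : A.relFrobenius p n ≫ ψ = lam) :
    p ^ (n * A.dim) * Hom.kerRank ψ = Hom.kerRank lam := by
  rw [← h, (A.isIsogeny_relFrobenius p n).kerRank_comp (isIsogeny_of_relFrobenius_comp_eq p n ψ hlam h),
    A.kerRank_relFrobenius p n]

/-- **A factor `ψ` of an isogeny `λ` of degree `q^{dim A}` through `F_{A/k}` is an ISOMORPHISM** (over a perfect
field): `deg ψ = 1` by `pow_mul_kerRank_of_relFrobenius_comp_eq`, and an isogeny of degree one is an isomorphism
(`IsIsogeny.isIso_of_kerRank_eq_one`) — Shimura's «`Ỹ` is a birational, hence biregular, correspondence».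
[cite: Shimura1998, §13.1 proof of Thm. 1 (pp. 97–99) and §18.6 proof of Thm. 18.6 (p. 127)] -/
theorem isIso_of_relFrobenius_comp_eq [PerfectField k] (ψ : A.frobeniusTwist p n ⟶ B) {lam : A ⟶ B}
    (hlam : IsIsogeny lam) (h : A.relFrobenius p n ≫ ψ = lam) (hdeg : Hom.kerRank lam = p ^ (n * A.dim)) :
    IsIso ψ := by
  have hψ := isIsogeny_of_relFrobenius_comp_eq p n ψ hlam h
  have hmul := pow_mul_kerRank_of_relFrobenius_comp_eq p n ψ hlam h
  rw [hdeg] at hmul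
  have hq : 0 < p ^ (n * A.dim) := pow_pos (expChar_pos k p) _
  have h1 : Hom.kerRank ψ = 1 := by
    have : p ^ (n * A.dim) * Hom.kerRank ψ = p ^ (n * A.dim) * 1 := by rw [mul_one]; exact hmul
    exact Nat.eq_of_mul_eq_mul_left hq this
  exact hψ.isIso_of_kerRank_eq_one h1

/-- The same with the degree hypothesis in the «`N𝔮`» form used by the E2 assembly: if `deg λ ∣ q^{dim A}` (e.g.
`deg λ = N𝔮 ≤ q^{dim}`) then already `deg ψ = 1`; stated as: `deg λ ≤ q^{dim A}` forces `ψ` to be an isomorphism.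
[cite: Shimura1998, §13.1 proof of Thm. 1 (pp. 97–99)] -/
theorem isIso_of_relFrobenius_comp_eq_of_kerRank_le [PerfectField k] (ψ : A.frobeniusTwist p n ⟶ B) {lam : A ⟶ B}
    (hlam : IsIsogeny lam) (h : A.relFrobenius p n ≫ ψ = lam) (hdeg : Hom.kerRank lam ≤ p ^ (n * A.dim)) :
    IsIso ψ := by
  have hψ := isIsogeny_of_relFrobenius_comp_eq p n ψ hlam h
  have hmul := pow_mul_kerRank_of_relFrobenius_comp_eq p n ψ hlam h
  have hq : 0 < p ^ (n * A.dim) := pow_pos (expChar_pos k p) _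
  have hk0 : Hom.kerRank ψ ≠ 0 := by
    haveI := hψ.2
    exact (Hom.kerRank_pos ψ).ne'
  refine isIso_of_relFrobenius_comp_eq p n ψ hlam h (le_antisymm hdeg ?_)
  calc p ^ (n * A.dim) = p ^ (n * A.dim) * 1 := (mul_one _).symm
    _ ≤ p ^ (n * A.dim) * Hom.kerRank ψ := Nat.mul_le_mul_left _ (Nat.one_le_iff_ne_zero.mpr hk0)
    _ = Hom.kerRank lam := hmul

/-! ## §2 Packaging for the assembly: cancelling `F_{A/k}`, equivariance of the factor, `B ≅ A^{(q)}` under `λ` -/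

/-- **`k`-homomorphisms out of `A^{(q)}` are determined by their composite with `F_{A/k}`** (`k` perfect: `F_{A/k}`
is an epimorphism of schemes, `epi_relFrobeniusOver_left`, and `Hom` is faithful on underlying schemes).
[cite: Shimura1998, §13.1 proof of Thm. 1 (pp. 97–99)] -/
theorem eq_of_relFrobenius_comp_eq [PerfectField k] {C : AbelianVariety k} {g₁ g₂ : A.frobeniusTwist p n ⟶ C}
    (h : A.relFrobenius p n ≫ g₁ = A.relFrobenius p n ≫ g₂) : g₁ = g₂ := by
  haveI : PerfectRing k p := PerfectField.toPerfectRing p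
  have h' : relFrobeniusOver p n A.X ≫ g₁.hom.hom.hom = relFrobeniusOver p n A.X ≫ g₂.hom.hom.hom :=
    congrArg (fun f : A ⟶ C => f.hom.hom.hom) h
  exact hom_ext _ _ (eq_of_relFrobeniusOver_comp_eq p n A.X h')

/-- **Equivariance of the factor**: if `F_{A/k} ≫ ψ = λ` and `α ≫ λ = λ ≫ β` (`α ∈ End A`, `β ∈ End B`), then
`α^{(q)} ≫ ψ = ψ ≫ β` — precompose with the epimorphism `F_{A/k}` and use `F_{A/k} ≫ α^{(q)} = α ≫ F_{A/k}`
(`relFrobenius_comp`).  Shimura: «`ψ ι̃_B(a) = ι̃_A(a)^f ψ` since both agree after `λ̃`».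
[cite: Shimura1998, §13.1 proof of Thm. 1 (pp. 97–99) and §18.6 proof of Thm. 18.6 (p. 127)] -/
theorem frobeniusTwist_comp_eq_comp_of_relFrobenius_comp_eq [PerfectField k] (ψ : A.frobeniusTwist p n ⟶ B)
    {lam : A ⟶ B} (h : A.relFrobenius p n ≫ ψ = lam) {α : A ⟶ A} {β : B ⟶ B} (hαβ : α ≫ lam = lam ≫ β) :
    Hom.frobeniusTwist p n α ≫ ψ = ψ ≫ β := by
  apply eq_of_relFrobenius_comp_eq p n (A := A)
  calc A.relFrobenius p n ≫ Hom.frobeniusTwist p n α ≫ ψ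
      = (α ≫ A.relFrobenius p n) ≫ ψ := by rw [← Category.assoc, relFrobenius_comp]
    _ = α ≫ lam := by rw [Category.assoc, h]
    _ = lam ≫ β := hαβ
    _ = A.relFrobenius p n ≫ ψ ≫ β := by rw [← Category.assoc, h]

/-- **The assembly shape** («there is an isomorphism `ψ : B → A^{(q)}` with `λ ≫ ψ = F_{A/k}`, compatible with given
commuting endomorphisms»): from a factorisation `F_{A/k} ≫ ψ = λ` of an isogeny `λ` of degree `q^{dim A}` over a
perfect field, `e := ψ⁻¹ : B ≅ A^{(q)}` satisfies `λ ≫ e = F_{A/k}` and `β ≫ e = e ≫ α^{(q)}` whenever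
`α ≫ λ = λ ≫ β` — the conclusion of `shimuraTaniyamaPair_degOne'` for `(A, B, λ) := (Ã, B̃, λ̃)`,
`α := ι̃_A(a)`, `β := ι̃_B(a)`. [cite: Shimura1998, §13.1 proof of Thm. 1 (pp. 97–99) and §18.6 proof of Thm. 18.6 (p. 127)] -/
theorem exists_iso_of_relFrobenius_comp_eq [PerfectField k] (ψ : A.frobeniusTwist p n ⟶ B) {lam : A ⟶ B}
    (hlam : IsIsogeny lam) (h : A.relFrobenius p n ≫ ψ = lam) (hdeg : Hom.kerRank lam = p ^ (n * A.dim)) :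
    ∃ e : B ≅ A.frobeniusTwist p n, lam ≫ e.hom = A.relFrobenius p n ∧
      ∀ (α : A ⟶ A) (β : B ⟶ B), α ≫ lam = lam ≫ β → β ≫ e.hom = e.hom ≫ Hom.frobeniusTwist p n α := by
  haveI := isIso_of_relFrobenius_comp_eq p n ψ hlam h hdeg
  refine ⟨(asIso ψ).symm, ?_, fun α β hαβ => ?_⟩
  · rw [Iso.symm_hom, asIso_inv, IsIso.comp_inv_eq, h]
  · have hc := frobeniusTwist_comp_eq_comp_of_relFrobenius_comp_eq p n ψ h hαβ
    rw [Iso.symm_hom, asIso_inv, IsIso.comp_inv_eq, Category.assoc, IsIso.eq_inv_comp, hc]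

end AbelianVariety

end Literature.AlgebraicGeometry.Motives

end
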